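import Summits.CriticalPhenomena.PercolationContinuityZ3.Theorems.PercNearOneGluingNoHeavyLowerTailSahiMixtureHereditaryCex5

/-!
# A BARRIER for coordinate induction: Sahi positivity for ALL increasing events is NOT preserved by an independent coin

Support file of the one-cut programme (crux `NoHeavyLowerTail`, stmt-CriticalPhenomena-4575; cell `prim-masterthm`, seat P3, gen 8; HIERARCHY.md §15).
Continues `…SahiMixtureHereditaryCex6` (lead gen 33: level vectors `lv`, masses `wN`) and `…SahiMixtureHereditaryCex5` (this seat: `sahiE_three_cex5`).
QUESTION.  The law-level classes `K ⊋ 𝒦` are not preserved under OR-mixing an independent coin (n = 4 resp. 5).  The LARGEST row-defined class is the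
LATTICE class `ℒ`: EVERY up-set of the pattern poset (every event of the distributive lattice generated by the events) is Sahi-nonnegative at every
order — the conclusion of Sahi's conjecture for all increasing events.  Were `ℒ` closed under product with an independent Bernoulli coordinate, (M-k) for
every product measure and every `k` would follow by induction on coordinates from the one-point space (equivalently: the one-coordinate step would be
certifiable from the full increasing-event row bank of the minor).
ANSWER: NO.  (1) **`latticePositive_cex6`**: under `cex6Weight` EVERY slot map into up-sets of the 14-point support poset `P14 = (Fin 14, lv-order)` has
`E_m ≥ 0` — `P14` has width `3` (`no_antichain_four`), so by the uncovered reduction only orders `≤ 3` matter, and those are finite integer checks over the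
`61` up-sets (`E2L_nonneg`, `E3L_nonneg_of_uncov`, `decide +kernel`; every `lv`-up-set is tabulated: `exists_eq_upSet`).  (2) **`isUpLvCoin_cex5_slots`** +
`sahiE_three_cex5`: the events `P_0 ∪ (H∩Q_0)`, `P_1 ∪ (H∩Q_1)`, `P_2` are up-sets of the product poset `P14 × {0<1}` with cubic row `−6447/250000000` under
`cex6Weight ⊗ coin(1/2)`.  (3) **`latticePositive_not_coin_stable`**.  CONSEQUENCES (HIERARCHY §15): `ℒ ⊗ coin ⊄ ℒ`, `ℒ ⊗ ℒ ⊄ ℒ`, the single-generator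
OR-mixing step over `ℒ` fails (Boolean embedding in `2^[7]`, seat script `work/lstep/lstep7_check.py`): no hypothesis on the minor law implied by nonnegativity
of its increasing-event Sahi rows (the law is even positively associated) suffices for the one-coordinate step of (M-k); a coordinate induction must use the
product structure (comb level, `SahiCombHereditary.CombHereditaryMixture`) or a non-row property such as log-supermodularity (`cex6Weight` is not FKG).
HONEST FRAMING: a law-level negative result; nothing here bears on Sahi's `C_k` for FKG or product measures. [this work]
-/

namespace Summit.CriticalPhenomena.PercolationContinuityZ3.Theorems

open Finset Function
open Literature.Combinatorics.Sahi2008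
open Literature.Probability.Percolation.DecisionTree (ind ind_of_mem ind_of_not_mem ind_nonneg)

namespace SahiMixture

/-! ### The 61 up-sets of the 14-point pattern poset, as bit masks -/

/-- The up-sets of `P14 = (Fin 14, x ≤ y ↔ lv x ≤ lv y)` as 14-bit masks (bit `x` set iff atom `x` belongs), all `61` of them including `∅` and the whole
space, in increasing order. [this work] -/
def upMask : Fin 61 → ℕ :=
  ![0, 8192, 9216, 9344, 10240, 10496, 11264, 11392, 11520, 11648, 12288, 12800, 13312, 13440, 13824, 13952, 14336, 14592, 14848, 15104, 15360,
    15488, 15504, 15616, 15648, 15744, 15760, 15776, 15792, 15794, 15872, 15936, 16000, 16016, 16064, 16080, 16084, 16128, 16160, 16192, 16224,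
    16232, 16256, 16272, 16288, 16304, 16306, 16320, 16336, 16340, 16352, 16360, 16368, 16370, 16372, 16374, 16376, 16378, 16380, 16382, 16383]

/-- A mask is an up-set of `P14`: closed upwards along `lv`. [this work] -/
def isUpMask (M : ℕ) : Bool :=
  (List.finRange 14).all fun x => (List.finRange 14).all fun y => !(M.testBit x.val && lle (lv x) (lv y)) || M.testBit y.val

/-- Every tabulated mask is an up-set. [this work] -/
theorem isUpMask_upMask : ∀ a : Fin 61, isUpMask (upMask a) = true := by
  decide +kernel

set_option maxRecDepth 100000 in
/-- Completeness of the table, split form (high and low 7 bits). [this work] -/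
theorem upMask_complete_split : ∀ hi lo : Fin 128, isUpMask (128 * hi.val + lo.val) = true → ∃ a : Fin 61, upMask a = 128 * hi.val + lo.val := by
  decide +kernel

/-- **Completeness of the table**: every up-set mask below `2¹⁴` is tabulated. [this work] -/
theorem upMask_complete (M : ℕ) (hM : M < 16384) (hup : isUpMask M = true) : ∃ a : Fin 61, upMask a = M := by
  have h := upMask_complete_split ⟨M / 128, by omega⟩ ⟨M % 128, Nat.mod_lt _ (by norm_num)⟩
  have e : 128 * (M / 128) + M % 128 = M := Nat.div_add_mod M 128
  simp only [e] at h
  exact h hup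

/-- `P14` has width `3`: among any four atoms two are `lv`-comparable. [this work] -/
theorem no_antichain_four : ∀ p q r t : Fin 14,
    ¬ (lle (lv p) (lv q) = false ∧ lle (lv q) (lv p) = false ∧ lle (lv p) (lv r) = false ∧ lle (lv r) (lv p) = false ∧
       lle (lv p) (lv t) = false ∧ lle (lv t) (lv p) = false ∧ lle (lv q) (lv r) = false ∧ lle (lv r) (lv q) = false ∧
       lle (lv q) (lv t) = false ∧ lle (lv t) (lv q) = false ∧ lle (lv r) (lv t) = false ∧ lle (lv t) (lv r) = false) := by
  decide +kernel

/-! ### Masses and the integer rows of orders 2 and 3 -/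

/-- The mass (×500) carried by bit `i` of a mask. [this work] -/
def bitw (M : ℕ) (i w : ℕ) : ℕ := if M.testBit i then w else 0

/-- `500·μ` of a mask: the sum of the atom masses `wN = (38,38,38,38,2,2,2,71,71,71,5,5,5,114)` over its bits (written out, kernel-friendly). [this work] -/
def massN (M : ℕ) : ℕ :=
  bitw M 0 38 + bitw M 1 38 + bitw M 2 38 + bitw M 3 38 + bitw M 4 2 + bitw M 5 2 + bitw M 6 2 + bitw M 7 71 + bitw M 8 71 + bitw M 9 71
    + bitw M 10 5 + bitw M 11 5 + bitw M 12 5 + bitw M 13 114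

/-- Mask containment `M ⊆ N`. [this work] -/
def msub (M N : ℕ) : Bool := (M &&& N) == M

/-- The ordered triple of tabulated up-sets is UNCOVERED: no member contains the intersection of the other two. [this work] -/
def uncov3 (a b c : Fin 61) : Bool :=
  !(msub (upMask b &&& upMask c) (upMask a)) && !(msub (upMask a &&& upMask c) (upMask b)) && !(msub (upMask a &&& upMask b) (upMask c))

/-- `500²·E_2` of two tabulated up-sets. [this work] -/
def E2L (a b : Fin 61) : ℤ :=
  500 * (massN (upMask a &&& upMask b) : ℤ) - (massN (upMask a) : ℤ) * (massN (upMask b) : ℤ)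

/-- `500³·E_3` of three tabulated up-sets (`sahiE_three_apply`). [this work] -/
def E3L (a b c : Fin 61) : ℤ :=
  2 * 500 ^ 2 * (massN (upMask a &&& upMask b &&& upMask c) : ℤ)
    + (massN (upMask a) : ℤ) * (massN (upMask b) : ℤ) * (massN (upMask c) : ℤ)
    - 500 * ((massN (upMask a) : ℤ) * (massN (upMask b &&& upMask c) : ℤ) + (massN (upMask b) : ℤ) * (massN (upMask a &&& upMask c) : ℤ)
        + (massN (upMask c) : ℤ) * (massN (upMask a &&& upMask b) : ℤ))

/-- **All `61²` covariances of up-sets are `≥ 0`** (the law is positively associated on its pattern poset). [this work] -/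
theorem E2L_nonneg : ∀ a b : Fin 61, 0 ≤ E2L a b := by
  decide +kernel

set_option maxRecDepth 100000 in
/-- **Every UNCOVERED cubic row of up-sets is `≥ 0`** (`3 924` ordered triples; covered triples reduce to lower orders). [this work] -/
theorem E3L_nonneg_of_uncov : ∀ a b c : Fin 61, uncov3 a b c = true → 0 ≤ E3L a b c := by
  decide +kernel

/-! ### The tabulated up-sets as events; masses as expectations -/

/-- The tabulated up-set `a` as an event of the 14 atoms. [this work] -/
def upSet (a : Fin 61) : Set (Fin 14) := {x | (upMask a).testBit x.val = true}

/-- Membership in a tabulated up-set is the mask bit. [this work] -/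
theorem mem_upSet {a : Fin 61} {x : Fin 14} : x ∈ upSet a ↔ (upMask a).testBit x.val = true := Iff.rfl

/-- Semantics of `isUpMask`: the mask is closed upwards along `lv`. [this work] -/
theorem isUpMask_spec {M : ℕ} (h : isUpMask M = true) {x y : Fin 14} (hxy : lv x ≤ lv y) (hx : M.testBit x.val = true) :
    M.testBit y.val = true := by
  unfold isUpMask at h
  rw [List.all_eq_true] at h
  have hx' := h x (List.mem_finRange x)
  rw [List.all_eq_true] at hx'
  have hy := hx' y (List.mem_finRange y)
  have hle : lle (lv x) (lv y) = true := (lle_eq_true_iff _ _).2 hxy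
  rw [hx, hle] at hy
  simpa using hy

/-- Tabulated up-sets are up-sets. [this work] -/
theorem upSet_mono (a : Fin 61) {x y : Fin 14} (hxy : lv x ≤ lv y) (hx : x ∈ upSet a) : y ∈ upSet a :=
  isUpMask_spec (isUpMask_upMask a) hxy hx

/-- The real indicator of a mask. [this work] -/
noncomputable def indB (M : ℕ) : Fin 14 → ℝ := fun x => if M.testBit x.val = true then 1 else 0

/-- The indicator of a tabulated up-set is the indicator of its mask. [this work] -/
theorem ind_upSet (a : Fin 61) : ind (upSet a) = indB (upMask a) := by
  funext x
  unfold indB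
  by_cases h : (upMask a).testBit x.val = true
  · rw [if_pos h, ind_of_mem (mem_upSet.2 h)]
  · rw [if_neg h, ind_of_not_mem (fun hx => h (mem_upSet.1 hx))]

/-- Products of mask indicators are indicators of the AND mask. [this work] -/
theorem indB_mul (M N : ℕ) : indB M * indB N = indB (M &&& N) := by
  funext x
  simp only [indB, Pi.mul_apply, Nat.testBit_land]
  cases (M.testBit x.val) <;> cases (N.testBit x.val) <;> simp

/-- `500·μ` of a mask as a finite sum (bridge form). [this work] -/
def massS (M : ℕ) : ℕ := ∑ x : Fin 14, bitw M x.val (wN x)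

/-- The finite-sum mass equals the written-out mass. [this work] -/
theorem massS_eq_massN (M : ℕ) : massS M = massN M := by
  simp only [massS, massN, Fin.sum_univ_succ, Fin.sum_univ_zero, wN, Matrix.cons_val_zero, Matrix.cons_val_succ, Fin.val_zero, Fin.val_succ]
  ring

/-- Expectations of mask indicators are masses: `μ(M) = massN M / 500`. [this work] -/
theorem ex_indB (M : ℕ) : ex cex6Weight (indB M) = (massN M : ℝ) / 500 := by
  rw [← massS_eq_massN, ex_def, massS, Nat.cast_sum, Finset.sum_div]
  refine Finset.sum_congr rfl fun x _ => ?_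
  rw [cex6Weight_eq_wN]
  unfold indB bitw
  split_ifs <;> simp

/-- The order-2 row of two tabulated up-sets is `E2L / 500²`. [this work] -/
theorem sahiE_two_upSet (s : Fin 2 → Fin 61) :
    sahiE cex6Weight 2 (fun j => ind (upSet (s j))) = (E2L (s 0) (s 1) : ℝ) / 500 ^ 2 := by
  rw [sahiE_two_apply]
  simp only [ind_upSet, indB_mul, ex_indB, E2L]
  push_cast
  ring

/-- The order-3 row of three tabulated up-sets is `E3L / 500³`. [this work] -/
theorem sahiE_three_upSet (s : Fin 3 → Fin 61) :
    sahiE cex6Weight 3 (fun j => ind (upSet (s j))) = (E3L (s 0) (s 1) (s 2) : ℝ) / 500 ^ 3 := by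
  rw [sahiE_three_apply]
  simp only [ind_upSet, indB_mul, ex_indB, E3L]
  push_cast
  ring

/-! ### Uncovered slot maps of up-sets have at most three slots -/

/-- A private point of a slot in an uncovered slot map. [this work] -/
theorem exists_private {m : ℕ} (s : Fin m → Fin 61) (hs : Uncovered upSet s) (a : Fin m) :
    ∃ x : Fin 14, x ∉ upSet (s a) ∧ ∀ b, b ≠ a → x ∈ upSet (s b) := by
  obtain ⟨x, hx, hxa⟩ := Set.not_subset.1 (hs a)
  exact ⟨x, hxa, fun b hb => Set.mem_iInter₂.1 hx b (Finset.mem_erase.2 ⟨hb, Finset.mem_univ b⟩)⟩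

/-- **An uncovered slot map of up-sets of `P14` has at most `3` slots** (its private points form an antichain; width `3`). [this work] -/
theorem card_le_three_of_uncovered_upSet {m : ℕ} (s : Fin m → Fin 61) (hs : Uncovered upSet s) : m ≤ 3 := by
  by_contra hm
  choose x hx using exists_private s hs
  have hinc : ∀ a b, a ≠ b → lle (lv (x a)) (lv (x b)) = false := by
    intro a b hab
    by_contra h
    have hle : lv (x a) ≤ lv (x b) := (lle_eq_true_iff _ _).1 ((Bool.not_eq_false _).mp h)
    exact (hx b).1 (upSet_mono (s b) hle ((hx a).2 b (Ne.symm hab)))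
  have h4 : 3 < m := by omega
  let i0 : Fin m := ⟨0, by omega⟩; let i1 : Fin m := ⟨1, by omega⟩; let i2 : Fin m := ⟨2, by omega⟩; let i3 : Fin m := ⟨3, by omega⟩
  have n01 : i0 ≠ i1 := (fun h => by simp [i0, i1, Fin.ext_iff] at h); have n02 : i0 ≠ i2 := (fun h => by simp [i0, i2, Fin.ext_iff] at h)
  have n03 : i0 ≠ i3 := (fun h => by simp [i0, i3, Fin.ext_iff] at h); have n12 : i1 ≠ i2 := (fun h => by simp [i1, i2, Fin.ext_iff] at h)
  have n13 : i1 ≠ i3 := (fun h => by simp [i1, i3, Fin.ext_iff] at h); have n23 : i2 ≠ i3 := (fun h => by simp [i2, i3, Fin.ext_iff] at h)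
  exact no_antichain_four (x i0) (x i1) (x i2) (x i3)
    ⟨hinc i0 i1 n01, hinc i1 i0 n01.symm, hinc i0 i2 n02, hinc i2 i0 n02.symm, hinc i0 i3 n03, hinc i3 i0 n03.symm,
     hinc i1 i2 n12, hinc i2 i1 n12.symm, hinc i1 i3 n13, hinc i3 i1 n13.symm, hinc i2 i3 n23, hinc i3 i2 n23.symm⟩

/-- A private point refutes mask containment. [this work] -/
theorem msub_false_of_private {M N : ℕ} {x : Fin 14} (hM : M.testBit x.val = true) (hN : N.testBit x.val = false) : msub M N = false := by
  unfold msub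
  rw [beq_eq_false_iff_ne]
  intro heq
  have h := congrArg (fun K => Nat.testBit K x.val) heq
  simp only [Nat.testBit_land, hM, hN] at h
  simp at h

/-- An uncovered three-slot map of tabulated up-sets passes the mask-level guard `uncov3`. [this work] -/
theorem uncov3_of_uncovered (s : Fin 3 → Fin 61) (hs : Uncovered upSet s) : uncov3 (s 0) (s 1) (s 2) = true := by
  obtain ⟨x0, hx0, hx0'⟩ := exists_private s hs 0
  obtain ⟨x1, hx1, hx1'⟩ := exists_private s hs 1
  obtain ⟨x2, hx2, hx2'⟩ := exists_private s hs 2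
  have b0 : (upMask (s 0)).testBit x0.val = false := by simpa [mem_upSet] using hx0
  have b1 : (upMask (s 1)).testBit x1.val = false := (by simpa [mem_upSet] using hx1); have b2 : (upMask (s 2)).testBit x2.val = false := (by simpa [mem_upSet] using hx2)
  have a01 := mem_upSet.1 (hx0' 1 (by decide)); have a02 := mem_upSet.1 (hx0' 2 (by decide))
  have a10 := mem_upSet.1 (hx1' 0 (by decide)); have a12 := mem_upSet.1 (hx1' 2 (by decide))
  have a20 := mem_upSet.1 (hx2' 0 (by decide)); have a21 := mem_upSet.1 (hx2' 1 (by decide))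
  have m0 : msub (upMask (s 1) &&& upMask (s 2)) (upMask (s 0)) = false :=
    msub_false_of_private (by rw [Nat.testBit_land, a01, a02]; rfl) b0
  have m1 : msub (upMask (s 0) &&& upMask (s 2)) (upMask (s 1)) = false :=
    msub_false_of_private (by rw [Nat.testBit_land, a10, a12]; rfl) b1
  have m2 : msub (upMask (s 0) &&& upMask (s 1)) (upMask (s 2)) = false :=
    msub_false_of_private (by rw [Nat.testBit_land, a20, a21]; rfl) b2
  simp [uncov3, m0, m1, m2]

/-! ### Lattice positivity of the counterexample law -/

/-- Uncovered rows of tabulated up-sets are nonnegative (orders `≤ 3`, the finite checks). [this work] -/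
theorem sahiE_upSet_nonneg_of_uncovered {m : ℕ} (s : Fin m → Fin 61) (hs : Uncovered upSet s) :
    0 ≤ sahiE cex6Weight m (fun j => ind (upSet (s j))) := by
  have hm := card_le_three_of_uncovered_upSet s hs
  interval_cases m
  · rw [sahiE_zero]
  · rw [sahiE_one_apply]
    exact ex_nonneg cex6Weight_nonneg fun x => ind_nonneg _ x
  · rw [sahiE_two_upSet]
    exact div_nonneg (Int.cast_nonneg (E2L_nonneg _ _)) (by norm_num)
  · rw [sahiE_three_upSet]
    exact div_nonneg (Int.cast_nonneg (E3L_nonneg_of_uncov _ _ _ (uncov3_of_uncovered s hs))) (by norm_num)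

/-- **Every row (any order, any slot map) of tabulated up-sets of `P14` is nonnegative under `cex6Weight`.** [this work] -/
theorem sahiE_upSet_nonneg (m : ℕ) (s : Fin m → Fin 61) : 0 ≤ sahiE cex6Weight m (fun j => ind (upSet (s j))) :=
  sahiE_nonneg_of_uncovered cex6Weight_nonneg sum_cex6Weight upSet (fun _ s' hs' => sahiE_upSet_nonneg_of_uncovered s' hs') m s

/-! ### Every `lv`-up-set is tabulated -/

/-- `U ⊆ Fin 14` is an up-set of the pattern poset `P14` (`x ≤ y ↔ lv x ≤ lv y`). [this work] -/
def IsUpLv (U : Set (Fin 14)) : Prop := ∀ ⦃x y : Fin 14⦄, lv x ≤ lv y → x ∈ U → y ∈ U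

/-- The bit of atom `x` in the mask of `U`. [this work] -/
noncomputable def bitOf (U : Set (Fin 14)) (x : Fin 14) : ℕ := @ite _ (x ∈ U) (Classical.propDecidable _) (2 ^ x.val) 0

/-- The mask of a set of atoms. [this work] -/
noncomputable def maskOf (U : Set (Fin 14)) : ℕ :=
  bitOf U 0 ||| bitOf U 1 ||| bitOf U 2 ||| bitOf U 3 ||| bitOf U 4 ||| bitOf U 5 ||| bitOf U 6 ||| bitOf U 7 ||| bitOf U 8 ||| bitOf U 9
    ||| bitOf U 10 ||| bitOf U 11 ||| bitOf U 12 ||| bitOf U 13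

/-- Bits of a single-atom contribution. [this work] -/
theorem testBit_bitOf (U : Set (Fin 14)) (x y : Fin 14) : (bitOf U x).testBit y.val = true ↔ (x ∈ U ∧ x = y) := by
  unfold bitOf
  by_cases hx : x ∈ U
  · rw [if_pos hx, Nat.testBit_two_pow]
    constructor
    · intro h; exact ⟨hx, Fin.ext (of_decide_eq_true h)⟩
    · rintro ⟨-, rfl⟩; exact decide_eq_true rfl
  · rw [if_neg hx, Nat.zero_testBit]
    simp [hx]

/-- **The mask of `U` has bit `y` iff `y ∈ U`.** [this work] -/
theorem testBit_maskOf (U : Set (Fin 14)) (y : Fin 14) : (maskOf U).testBit y.val = true ↔ y ∈ U := by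
  simp only [maskOf, Nat.testBit_lor, Bool.or_eq_true, testBit_bitOf]
  constructor
  · intro h
    rcases h with (((((((((((((⟨h, rfl⟩ | ⟨h, rfl⟩) | ⟨h, rfl⟩) | ⟨h, rfl⟩) | ⟨h, rfl⟩) | ⟨h, rfl⟩) | ⟨h, rfl⟩) | ⟨h, rfl⟩) | ⟨h, rfl⟩) | ⟨h, rfl⟩)
      | ⟨h, rfl⟩) | ⟨h, rfl⟩) | ⟨h, rfl⟩) | ⟨h, rfl⟩) <;> assumption
  · intro hy
    fin_cases y
    · exact Or.inl (Or.inl (Or.inl (Or.inl (Or.inl (Or.inl (Or.inl (Or.inl (Or.inl (Or.inl (Or.inl (Or.inl (Or.inl ⟨hy, rfl⟩))))))))))))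
    · exact Or.inl (Or.inl (Or.inl (Or.inl (Or.inl (Or.inl (Or.inl (Or.inl (Or.inl (Or.inl (Or.inl (Or.inl (Or.inr ⟨hy, rfl⟩))))))))))))
    · exact Or.inl (Or.inl (Or.inl (Or.inl (Or.inl (Or.inl (Or.inl (Or.inl (Or.inl (Or.inl (Or.inl (Or.inr ⟨hy, rfl⟩)))))))))))
    · exact Or.inl (Or.inl (Or.inl (Or.inl (Or.inl (Or.inl (Or.inl (Or.inl (Or.inl (Or.inl (Or.inr ⟨hy, rfl⟩))))))))))
    · exact Or.inl (Or.inl (Or.inl (Or.inl (Or.inl (Or.inl (Or.inl (Or.inl (Or.inl (Or.inr ⟨hy, rfl⟩)))))))))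
    · exact Or.inl (Or.inl (Or.inl (Or.inl (Or.inl (Or.inl (Or.inl (Or.inl (Or.inr ⟨hy, rfl⟩))))))))
    · exact Or.inl (Or.inl (Or.inl (Or.inl (Or.inl (Or.inl (Or.inl (Or.inr ⟨hy, rfl⟩)))))))
    · exact Or.inl (Or.inl (Or.inl (Or.inl (Or.inl (Or.inl (Or.inr ⟨hy, rfl⟩))))))
    · exact Or.inl (Or.inl (Or.inl (Or.inl (Or.inl (Or.inr ⟨hy, rfl⟩)))))
    · exact Or.inl (Or.inl (Or.inl (Or.inl (Or.inr ⟨hy, rfl⟩))))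
    · exact Or.inl (Or.inl (Or.inl (Or.inr ⟨hy, rfl⟩)))
    · exact Or.inl (Or.inl (Or.inr ⟨hy, rfl⟩))
    · exact Or.inl (Or.inr ⟨hy, rfl⟩)
    · exact Or.inr ⟨hy, rfl⟩

/-- The mask of a set of atoms is below `2¹⁴`. [this work] -/
theorem maskOf_lt (U : Set (Fin 14)) : maskOf U < 16384 := by
  have hb : ∀ x : Fin 14, bitOf U x < 2 ^ 14 := fun x => by
    unfold bitOf
    split_ifs
    · exact Nat.pow_lt_pow_right (by norm_num) x.isLt
    · norm_num
  unfold maskOf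
  refine Nat.or_lt_two_pow (Nat.or_lt_two_pow (Nat.or_lt_two_pow (Nat.or_lt_two_pow (Nat.or_lt_two_pow (Nat.or_lt_two_pow (Nat.or_lt_two_pow
    (Nat.or_lt_two_pow (Nat.or_lt_two_pow (Nat.or_lt_two_pow (Nat.or_lt_two_pow (Nat.or_lt_two_pow (Nat.or_lt_two_pow (hb 0) (hb 1)) (hb 2))
    (hb 3)) (hb 4)) (hb 5)) (hb 6)) (hb 7)) (hb 8)) (hb 9)) (hb 10)) (hb 11)) (hb 12)) (hb 13)

/-- The mask of an `lv`-up-set passes `isUpMask`. [this work] -/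
theorem isUpMask_maskOf {U : Set (Fin 14)} (hU : IsUpLv U) : isUpMask (maskOf U) = true := by
  unfold isUpMask
  rw [List.all_eq_true]
  intro x _
  rw [List.all_eq_true]
  intro y _
  by_cases hx : (maskOf U).testBit x.val = true
  · by_cases hle : lle (lv x) (lv y) = true
    · have hy : (maskOf U).testBit y.val = true :=
        (testBit_maskOf U y).2 (hU ((lle_eq_true_iff _ _).1 hle) ((testBit_maskOf U x).1 hx))
      simp [hy]
    · simp [hle]
  · simp [hx]

/-- **Every `lv`-up-set of the 14 atoms is one of the 61 tabulated up-sets.** [this work] -/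
theorem exists_eq_upSet {U : Set (Fin 14)} (hU : IsUpLv U) : ∃ a : Fin 61, upSet a = U := by
  obtain ⟨a, ha⟩ := upMask_complete (maskOf U) (maskOf_lt U) (isUpMask_maskOf hU)
  refine ⟨a, Set.ext fun y => ?_⟩
  rw [mem_upSet, ha]
  exact testBit_maskOf U y

/-- **LATTICE POSITIVITY of the counterexample law**: under `cex6Weight`, EVERY family (any order, any multiplicities) of up-sets of the pattern poset
`P14` — every family of events of the distributive lattice generated by the six events `Q_j ⊇ P_j` — has `E_m ≥ 0`. [this work] -/
theorem latticePositive_cex6 (m : ℕ) (U : Fin m → Set (Fin 14)) (hU : ∀ j, IsUpLv (U j)) :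
    0 ≤ sahiE cex6Weight m (fun j => ind (U j)) := by
  choose a ha using fun j => exists_eq_upSet (hU j)
  have e : (fun j => ind (U j)) = fun j => ind (upSet (a j)) := by
    funext j; rw [ha j]
  rw [e]
  exact sahiE_upSet_nonneg m a

/-! ### … but the product with a fair coin is not lattice-positive -/

/-- `B ⊆ Fin 14 × Bool` is an up-set of the product poset `P14 × {false < true}`. [this work] -/
def IsUpLvCoin (B : Set (Fin 14 × Bool)) : Prop :=
  ∀ ⦃x y : Fin 14⦄ ⦃b c : Bool⦄, lv x ≤ lv y → (b = true → c = true) → (x, b) ∈ B → (y, c) ∈ B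

/-- A `mixEv P Q` of nested `lv`-up-sets `P ⊆ Q` is an up-set of the product poset. [this work] -/
theorem isUpLvCoin_mixEv {P Q : Set (Fin 14)} (hP : IsUpLv P) (hQ : IsUpLv Q) (hPQ : P ⊆ Q) : IsUpLvCoin (mixEv P Q) := by
  intro x y b c hxy hbc hxb
  simp only [mixEv, Set.mem_setOf_eq] at hxb ⊢
  rcases hxb with ⟨hb, hx⟩ | ⟨hb, hx⟩
  · cases c
    · exact Or.inl ⟨rfl, hP hxy hx⟩
    · exact Or.inr ⟨rfl, hQ hxy (hPQ hx)⟩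
  · cases c
    · exact absurd (hbc hb) (by simp)
    · exact Or.inr ⟨rfl, hQ hxy hx⟩

/-- Principal up-sets are `lv`-up-sets. [this work] -/
theorem isUpLv_upEv (l : Lvl) : IsUpLv (upEv l) := fun _ _ hxy hx => mem_upEv.2 (le_trans (mem_upEv.1 hx) hxy)

/-- `P_j` and `Q_j` are `lv`-up-sets. [this work] -/
theorem isUpLv_cex6PQ (j : Fin 3) : IsUpLv (cex6P j) ∧ IsUpLv (cex6Q j) := by
  obtain ⟨q0, q1, q2⟩ := cex6Q_eq_upEv
  obtain ⟨p0, p1, p2⟩ := cex6P_eq_upEv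
  fin_cases j
  · exact ⟨p0 ▸ isUpLv_upEv _, q0 ▸ isUpLv_upEv _⟩
  · exact ⟨p1 ▸ isUpLv_upEv _, q1 ▸ isUpLv_upEv _⟩
  · exact ⟨p2 ▸ isUpLv_upEv _, q2 ▸ isUpLv_upEv _⟩

/-- **The three slots of the five-event violation are up-sets of the product poset.** [this work] -/
theorem isUpLvCoin_cex5_slots :
    IsUpLvCoin (mixEv (cex6P 0) (cex6Q 0)) ∧ IsUpLvCoin (mixEv (cex6P 1) (cex6Q 1)) ∧ IsUpLvCoin (mixEv (cex6P 2) (cex6P 2)) :=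
  ⟨isUpLvCoin_mixEv (isUpLv_cex6PQ 0).1 (isUpLv_cex6PQ 0).2 (cex6P_subset_Q 0),
   isUpLvCoin_mixEv (isUpLv_cex6PQ 1).1 (isUpLv_cex6PQ 1).2 (cex6P_subset_Q 1),
   isUpLvCoin_mixEv (isUpLv_cex6PQ 2).1 (isUpLv_cex6PQ 2).1 subset_rfl⟩

/-- **BARRIER THEOREM: lattice positivity is not stable under an independent coin.**  `cex6Weight` is Sahi-nonnegative on EVERY family of up-sets of its
pattern poset (all orders), yet under its product with an independent fair coin (`coinWeight cex6Weight (1/2)`) three up-sets of the product poset have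
`E_3 = −6447/250000000 < 0`. [this work] -/
theorem latticePositive_not_coin_stable :
    (∀ (m : ℕ) (U : Fin m → Set (Fin 14)), (∀ j, IsUpLv (U j)) → 0 ≤ sahiE cex6Weight m (fun j => ind (U j))) ∧
    ∃ B : Fin 3 → Set (Fin 14 × Bool), (∀ j, IsUpLvCoin (B j)) ∧ sahiE (coinWeight cex6Weight (1/2 : ℝ)) 3 (fun j => ind (B j)) < 0 := by
  refine ⟨latticePositive_cex6, ![mixEv (cex6P 0) (cex6Q 0), mixEv (cex6P 1) (cex6Q 1), mixEv (cex6P 2) (cex6P 2)], ?_, ?_⟩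
  · obtain ⟨h0, h1, h2⟩ := isUpLvCoin_cex5_slots
    intro j; fin_cases j
    · exact h0
    · exact h1
    · exact h2
  · have e : (fun j => ind ((![mixEv (cex6P 0) (cex6Q 0), mixEv (cex6P 1) (cex6Q 1), mixEv (cex6P 2) (cex6P 2)] : Fin 3 → Set (Fin 14 × Bool)) j))
        = ![ind (mixEv (cex6P 0) (cex6Q 0)), ind (mixEv (cex6P 1) (cex6Q 1)), ind (mixEv (cex6P 2) (cex6P 2))] := by
      funext j; fin_cases j <;> rfl
    rw [e, sahiE_three_cex5]
    norm_num

end SahiMixture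

end Summit.CriticalPhenomena.PercolationContinuityZ3.Theorems
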